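import Summits.CriticalPhenomena.PercolationContinuityZ3.Theorems.PercNearOneGluingNoHeavyLowerTailBlockSeparation
import Summits.CriticalPhenomena.PercolationContinuityZ3.Theorems.PercNearOneGluingNearOneGluingSingleFinger
import Summits.CriticalPhenomena.PercolationContinuityZ3.Theorems.PercNearOneGluingNearOneGluingWeightContinuity
import HarnessLib

/-!
# `NoHeavyLowerTail` (stmt-CriticalPhenomena-4575), one-cut line — Kozma–Nitzan Lemma 2 with GENERAL BLOCKS
# (the block lonely relay lemma / antichain bound), unconditionally

For a finite weighted graph on `Fin n` (`μ = prodBernoulli w`), an observer `o`, a relay set `A` and a family `𝓑` of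
pairwise disjoint relay blocks `B ⊆ A`, write `E_B = {o ↔ B}` (`o` joined to some vertex of `B`) and
`D_B = {B ↮ A ∖ B}` (no vertex of `B` joined to a relay outside `B`).  Then

  `Σ_{B ∈ 𝓑} μ(E_B ∩ D_B) ≤ max_{B ∈ 𝓑} μ(D_B)`                               (`blockLonelyRelay`)

(stated with a common bound `t ≥ μ(D_B)`), which is Kozma–Nitzan's Lemma 2 (arXiv:2401.12397 p. 6:
`Σ_k φ(X_k) ≤ φ(X) ≤ 1`, `φ(B) = P(o ↔ B | B ↮ A∖B)`) for the blocks `B ∈ 𝓑` of `X = A`.  Consequence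
(`disjointClusters_sum_le`): since `{C(o) ∩ A = B} ⊆ E_B ∩ D_B`, for pairwise DISJOINT candidate values `B` of the
captured relay set, `Σ_B P(C(o) ∩ A = B) ≤ max_B P(B ↮ A∖B)` — no factor `|𝓑|`: popular disjoint clusters cannot
coexist ("antichain bound" of ONE-CUT-STRUCTURE.md; the singleton case is `Theorems.lonelyRelay`).
Mechanism: block terminal separation (`blockTerminalSeparation`, KN Lemma 1(i) by gluing) with `T = A ∖ B` and
`Q_B` = "the other blocks are separated from the rest", so that `D_B ∩ Q_B = M` := all blocks separated from their
complements; the events `E_B ∩ M` are pairwise disjoint; sum and divide by `μ(M) > 0`, the null case removed by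
scaling the weights (`stub_weightContinuity`).
-/

namespace Summit.CriticalPhenomena.PercolationContinuityZ3.Theorems

open scoped BigOperators Classical Topology
open MeasureTheory Set Filter
open Literature.Probability.LatticeModels (prodBernoulli)
open Literature.Probability.Percolation

variable {n : ℕ}

namespace BlockLonelyRelay

/-- The pair set `P_B`: pairs `(b', a)` with `b'` in another block `B'` and `a ∈ A ∖ (B' ∪ B)`. [this file] -/
theorem mem_pairs_iff {A B : Finset (Fin n)} {𝓑 : Finset (Finset (Fin n))} {p : Fin n × Fin n} :
    p ∈ (𝓑.erase B).biUnion (fun B' => B' ×ˢ (A \ (B' ∪ B))) ↔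
      ∃ B' ∈ 𝓑, B' ≠ B ∧ p.1 ∈ B' ∧ p.2 ∈ A ∧ p.2 ∉ B' ∧ p.2 ∉ B := by
  simp only [Finset.mem_biUnion, Finset.mem_erase, Finset.mem_product, Finset.mem_sdiff,
    Finset.mem_union, not_or]
  constructor
  · rintro ⟨B', ⟨hne, hB'⟩, h1, h2, h3, h4⟩
    exact ⟨B', hB', hne, h1, h2, h3, h4⟩
  · rintro ⟨B', hB', hne, h1, h2, h3, h4⟩
    exact ⟨B', ⟨hne, hB'⟩, h1, h2, h3, h4⟩

/-- `D_B ∩ Q_B = M` (all blocks separated from their complements in `A`). [this file] -/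
theorem sep_inter_pairs_eq {A B : Finset (Fin n)} {𝓑 : Finset (Finset (Fin n))} (hB : B ∈ 𝓑)
    (hsub : ∀ B' ∈ 𝓑, B' ⊆ A) (hdisj : ∀ B' ∈ 𝓑, ∀ B'' ∈ 𝓑, B' ≠ B'' → Disjoint B' B'') :
    ({ω : BondConfig (Fin n) | ∀ b ∈ B, ∀ a ∈ A \ B, ω ∉ openConn b a} ∩
        {ω | ∀ p ∈ (𝓑.erase B).biUnion (fun B' => B' ×ˢ (A \ (B' ∪ B))), ω ∉ openConn p.1 p.2}) =
      {ω | ∀ B' ∈ 𝓑, ∀ b ∈ B', ∀ a ∈ A \ B', ω ∉ openConn b a} := by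
  ext ω
  simp only [mem_inter_iff, mem_setOf_eq]
  constructor
  · rintro ⟨hD, hQ⟩ B' hB' b hb a ha
    obtain ⟨haA, haB'⟩ := Finset.mem_sdiff.1 ha
    by_cases hBB : B' = B
    · subst hBB; exact hD b hb a ha
    · by_cases haB : a ∈ B
      · -- `a ∈ B`, `b ∈ B' ⊆ A ∖ B`: use `D_B` backwards
        have hbA : b ∈ A := hsub B' hB' hb
        have hbB : b ∉ B := fun hbB => (Finset.disjoint_left.1 (hdisj B' hB' B hB hBB)) hb hbB
        intro h
        exact hD a haB b (Finset.mem_sdiff.2 ⟨hbA, hbB⟩) (SimpleGraph.Reachable.symm h)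
      · exact hQ (b, a) (mem_pairs_iff.2 ⟨B', hB', hBB, hb, haA, haB', haB⟩)
  · intro hM
    refine ⟨hM B hB, fun p hp => ?_⟩
    obtain ⟨B', hB', _, h1, h2, h3, _⟩ := mem_pairs_iff.1 hp
    exact hM B' hB' p.1 h1 p.2 (Finset.mem_sdiff.2 ⟨h2, h3⟩)

/-- The events `{o ↔ B} ∩ M`, `B ∈ 𝓑`, are pairwise disjoint. [this file] -/
theorem pairwiseDisjoint_join_inter {A : Finset (Fin n)} (𝓑 : Finset (Finset (Fin n))) (o : Fin n)
    (hsub : ∀ B' ∈ 𝓑, B' ⊆ A) (hdisj : ∀ B' ∈ 𝓑, ∀ B'' ∈ 𝓑, B' ≠ B'' → Disjoint B' B'') :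
    (↑𝓑 : Set (Finset (Fin n))).PairwiseDisjoint fun B =>
      {ω : BondConfig (Fin n) | ∃ b ∈ B, ω ∈ openConn o b} ∩
        {ω | ∀ B' ∈ 𝓑, ∀ b ∈ B', ∀ a ∈ A \ B', ω ∉ openConn b a} := by
  intro B hB B' hB' hne
  simp only [Function.onFun]
  refine Set.disjoint_left.2 fun ω hω hω' => ?_
  obtain ⟨⟨b, hb, hob⟩, hM⟩ := hω
  obtain ⟨⟨b', hb', hob'⟩, -⟩ := hω'
  have hbb : (openGraph ω).Reachable b b' :=
    (SimpleGraph.Reachable.symm (hob : (openGraph ω).Reachable o b)).trans hob'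
  have hb'A : b' ∈ A := hsub B' (Finset.mem_coe.1 hB') hb'
  have hb'B : b' ∉ B := fun h =>
    (Finset.disjoint_left.1 (hdisj B (Finset.mem_coe.1 hB) B' (Finset.mem_coe.1 hB') hne)) h hb'
  exact hM B (Finset.mem_coe.1 hB) b hb b' (Finset.mem_sdiff.2 ⟨hb'A, hb'B⟩) hbb

/-- `M ⊇ {A pairwise separated}`; in particular `μ(M) > 0` when all weights are `< 1`. [this file] -/
theorem sepAll_subset_M (A : Finset (Fin n)) (𝓑 : Finset (Finset (Fin n))) (hsub : ∀ B' ∈ 𝓑, B' ⊆ A)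
    (hdisj : ∀ B' ∈ 𝓑, ∀ B'' ∈ 𝓑, B' ≠ B'' → Disjoint B' B'') :
    {ω : BondConfig (Fin n) | ∀ x ∈ A, ∀ y ∈ A, x ≠ y → ω ∉ openConn x y} ⊆
      {ω | ∀ B' ∈ 𝓑, ∀ b ∈ B', ∀ a ∈ A \ B', ω ∉ openConn b a} := by
  intro ω hω B' hB' b hb a ha
  obtain ⟨haA, haB'⟩ := Finset.mem_sdiff.1 ha
  have _ := hdisj
  exact hω b (hsub B' hB' hb) a haA (fun h => haB' (h ▸ hb))

/-- **Block lonely relay bound when `μ(M) > 0`.** [cite: KozmaNitzan2024, Lemma 2 (p. 6)] -/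
theorem blockLonelyRelay_of_pos (w : Sym2 (Fin n) → unitInterval) (A : Finset (Fin n)) (o : Fin n)
    (𝓑 : Finset (Finset (Fin n))) (hsub : ∀ B ∈ 𝓑, B ⊆ A)
    (hdisj : ∀ B' ∈ 𝓑, ∀ B'' ∈ 𝓑, B' ≠ B'' → Disjoint B' B'') (t : ℝ) (ht : 0 ≤ t)
    (hq : ∀ B ∈ 𝓑, (prodBernoulli w).real {ω | ∀ b ∈ B, ∀ a ∈ A \ B, ω ∉ openConn b a} ≤ t)
    (hM : 0 < (prodBernoulli w).real {ω | ∀ B' ∈ 𝓑, ∀ b ∈ B', ∀ a ∈ A \ B', ω ∉ openConn b a}) :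
    ∑ B ∈ 𝓑, (prodBernoulli w).real ({ω | ∃ b ∈ B, ω ∈ openConn o b} ∩
        {ω | ∀ b ∈ B, ∀ a ∈ A \ B, ω ∉ openConn b a}) ≤ t := by
  set μ := prodBernoulli w with hμ
  set M : Set (BondConfig (Fin n)) := {ω | ∀ B' ∈ 𝓑, ∀ b ∈ B', ∀ a ∈ A \ B', ω ∉ openConn b a} with hMdef
  -- termwise: block terminal separation with `T = A \ B`, `Q = Q_B`
  have h2 : ∀ B ∈ 𝓑,
      μ.real ({ω | ∃ b ∈ B, ω ∈ openConn o b} ∩ {ω | ∀ b ∈ B, ∀ a ∈ A \ B, ω ∉ openConn b a}) * μ.real M ≤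
        t * μ.real ({ω | ∃ b ∈ B, ω ∈ openConn o b} ∩ M) := by
    intro B hB
    have hP : ∀ p ∈ (𝓑.erase B).biUnion (fun B' => B' ×ˢ (A \ (B' ∪ B))), p.1 ∈ A \ B := by
      intro p hp
      obtain ⟨B', hB', hne, h1, _, _, _⟩ := mem_pairs_iff.1 hp
      exact Finset.mem_sdiff.2 ⟨hsub B' hB' h1,
        fun h => (Finset.disjoint_left.1 (hdisj B' hB' B hB hne)) h1 h⟩
    have key := blockTerminalSeparation w B (A \ B) o _ hP
    rw [sep_inter_pairs_eq hB hsub hdisj] at key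
    calc μ.real ({ω | ∃ b ∈ B, ω ∈ openConn o b} ∩ {ω | ∀ b ∈ B, ∀ a ∈ A \ B, ω ∉ openConn b a}) *
          μ.real M
        ≤ μ.real {ω | ∀ b ∈ B, ∀ a ∈ A \ B, ω ∉ openConn b a} *
            μ.real ({ω | ∃ b ∈ B, ω ∈ openConn o b} ∩ M) := key
      _ ≤ t * μ.real ({ω | ∃ b ∈ B, ω ∈ openConn o b} ∩ M) :=
          mul_le_mul_of_nonneg_right (hq B hB) measureReal_nonneg
  -- disjointness
  have h3 : ∑ B ∈ 𝓑, μ.real ({ω | ∃ b ∈ B, ω ∈ openConn o b} ∩ M) ≤ μ.real M := by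
    rw [← measureReal_biUnion_finset (pairwiseDisjoint_join_inter 𝓑 o hsub hdisj)
      (fun B _ => MeasurableSet.of_discrete)]
    exact measureReal_mono (Set.iUnion₂_subset fun B _ => Set.inter_subset_right)
  have h4 : (∑ B ∈ 𝓑, μ.real ({ω | ∃ b ∈ B, ω ∈ openConn o b} ∩
      {ω | ∀ b ∈ B, ∀ a ∈ A \ B, ω ∉ openConn b a})) * μ.real M ≤ t * μ.real M := by
    rw [Finset.sum_mul]
    calc ∑ B ∈ 𝓑, μ.real ({ω | ∃ b ∈ B, ω ∈ openConn o b} ∩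
            {ω | ∀ b ∈ B, ∀ a ∈ A \ B, ω ∉ openConn b a}) * μ.real M
        ≤ ∑ B ∈ 𝓑, t * μ.real ({ω | ∃ b ∈ B, ω ∈ openConn o b} ∩ M) := Finset.sum_le_sum h2
      _ = t * ∑ B ∈ 𝓑, μ.real ({ω | ∃ b ∈ B, ω ∈ openConn o b} ∩ M) := (Finset.mul_sum _ _ _).symm
      _ ≤ t * μ.real M := mul_le_mul_of_nonneg_left h3 ht
  exact le_of_mul_le_mul_right h4 hM

end BlockLonelyRelay

open BlockLonelyRelay in
/-- **Kozma–Nitzan Lemma 2 with general blocks (block lonely relay lemma), unconditional.**  For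
`μ = prodBernoulli w` on `Fin n`, an observer `o`, a relay set `A`, a family `𝓑` of pairwise disjoint blocks
`B ⊆ A`, and `t ≥ 0` with `μ(B ↮ A∖B) ≤ t` for every `B ∈ 𝓑`:
`Σ_{B∈𝓑} μ({o ↔ B} ∩ {B ↮ A∖B}) ≤ t`.
[cite: KozmaNitzan2024, Lemma 2 (p. 6); VandenbergHaggstromKahn2005, Thm. 1.3] -/
theorem blockLonelyRelay (w : Sym2 (Fin n) → unitInterval) (A : Finset (Fin n)) (o : Fin n)
    (𝓑 : Finset (Finset (Fin n))) (hsub : ∀ B ∈ 𝓑, B ⊆ A)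
    (hdisj : ∀ B' ∈ 𝓑, ∀ B'' ∈ 𝓑, B' ≠ B'' → Disjoint B' B'') (t : ℝ) (ht : 0 ≤ t)
    (hq : ∀ B ∈ 𝓑, (prodBernoulli w).real {ω | ∀ b ∈ B, ∀ a ∈ A \ B, ω ∉ openConn b a} ≤ t) :
    ∑ B ∈ 𝓑, (prodBernoulli w).real ({ω | ∃ b ∈ B, ω ∈ openConn o b} ∩
        {ω | ∀ b ∈ B, ∀ a ∈ A \ B, ω ∉ openConn b a}) ≤ t := by
  -- scaled weights `w_k = (1 - 1/(k+1)) • w`, all `< 1`, converging to `w`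
  have hcmem : ∀ k : ℕ, ((1 : ℝ) - 1 / ((k : ℝ) + 1)) ∈ unitInterval := by
    intro k
    have hk : (0 : ℝ) < (k : ℝ) + 1 := Nat.cast_add_one_pos k
    have h1 : 1 / ((k : ℝ) + 1) ≤ 1 := by
      rw [div_le_one hk]; linarith [(Nat.cast_nonneg k : (0 : ℝ) ≤ k)]
    have h0 : 0 ≤ 1 / ((k : ℝ) + 1) := by positivity
    exact ⟨by linarith, by linarith⟩
  set wk : ℕ → Sym2 (Fin n) → unitInterval :=
    fun k e => ⟨(1 - 1 / ((k : ℝ) + 1)) * (w e : ℝ), unitInterval.mul_mem (hcmem k) (w e).2⟩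
    with hwk_def
  have hwk_lt : ∀ k e, ((wk k e : unitInterval) : ℝ) < 1 := by
    intro k e
    have hk : (0 : ℝ) < (k : ℝ) + 1 := Nat.cast_add_one_pos k
    have hc : (1 : ℝ) - 1 / ((k : ℝ) + 1) < 1 := by
      have : 0 < 1 / ((k : ℝ) + 1) := by positivity
      linarith
    calc ((wk k e : unitInterval) : ℝ) = (1 - 1 / ((k : ℝ) + 1)) * (w e : ℝ) := rfl
      _ ≤ (1 - 1 / ((k : ℝ) + 1)) := mul_le_of_le_one_right (hcmem k).1 (w e).2.2
      _ < 1 := hc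
  have hc_lim : Tendsto (fun k : ℕ => (1 : ℝ) - 1 / ((k : ℝ) + 1)) atTop (𝓝 1) := by
    simpa using tendsto_const_nhds.sub (tendsto_one_div_add_atTop_nhds_zero_nat (𝕜 := ℝ))
  have hwk_lim : Tendsto wk atTop (𝓝 w) := by
    refine tendsto_pi_nhds.2 fun e => ?_
    rw [tendsto_subtype_rng]
    have h := hc_lim.mul_const (w e : ℝ)
    rw [one_mul] at h
    exact h
  have hlimE : ∀ E : Set (Set (Sym2 (Fin n))),
      Tendsto (fun k => (prodBernoulli (wk k)).real E) atTop (𝓝 ((prodBernoulli w).real E)) :=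
    fun E => ((stub_weightContinuity n E).tendsto w).comp hwk_lim
  -- error terms
  set δ : ℕ → ℝ := fun k => ∑ B ∈ 𝓑,
      |(prodBernoulli (wk k)).real {ω | ∀ b ∈ B, ∀ a ∈ A \ B, ω ∉ openConn b a} -
        (prodBernoulli w).real {ω | ∀ b ∈ B, ∀ a ∈ A \ B, ω ∉ openConn b a}| with hδ_def
  have hδ0 : ∀ k, 0 ≤ δ k := fun k => Finset.sum_nonneg fun B _ => abs_nonneg _
  have hδ_lim : Tendsto δ atTop (𝓝 0) := by
    have h : ∀ B ∈ 𝓑, Tendsto (fun k =>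
        |(prodBernoulli (wk k)).real {ω | ∀ b ∈ B, ∀ a ∈ A \ B, ω ∉ openConn b a} -
          (prodBernoulli w).real {ω | ∀ b ∈ B, ∀ a ∈ A \ B, ω ∉ openConn b a}|) atTop (𝓝 0) := by
      intro B _
      simpa using (tendsto_sub_nhds_zero_iff.2
        (hlimE {ω | ∀ b ∈ B, ∀ a ∈ A \ B, ω ∉ openConn b a})).abs
    simpa [hδ_def] using tendsto_finsetSum 𝓑 h
  -- the bound at each `k`
  have hk : ∀ k, ∑ B ∈ 𝓑, (prodBernoulli (wk k)).real ({ω | ∃ b ∈ B, ω ∈ openConn o b} ∩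
      {ω | ∀ b ∈ B, ∀ a ∈ A \ B, ω ∉ openConn b a}) ≤ t + δ k := by
    intro k
    refine blockLonelyRelay_of_pos (wk k) A o 𝓑 hsub hdisj (t + δ k) (by linarith [hδ0 k]) ?_ ?_
    · intro B hB
      have h1 := hq B hB
      have h2 : |(prodBernoulli (wk k)).real {ω | ∀ b ∈ B, ∀ a ∈ A \ B, ω ∉ openConn b a} -
            (prodBernoulli w).real {ω | ∀ b ∈ B, ∀ a ∈ A \ B, ω ∉ openConn b a}| ≤ δ k :=
        Finset.single_le_sum (f := fun B =>
          |(prodBernoulli (wk k)).real {ω | ∀ b ∈ B, ∀ a ∈ A \ B, ω ∉ openConn b a} -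
            (prodBernoulli w).real {ω | ∀ b ∈ B, ∀ a ∈ A \ B, ω ∉ openConn b a}|)
          (fun B _ => abs_nonneg _) hB
      have h3 := le_abs_self
        ((prodBernoulli (wk k)).real {ω | ∀ b ∈ B, ∀ a ∈ A \ B, ω ∉ openConn b a} -
          (prodBernoulli w).real {ω | ∀ b ∈ B, ∀ a ∈ A \ B, ω ∉ openConn b a})
      linarith
    · exact lt_of_lt_of_le (singleFinger_pairSep_real_pos (wk k) (hwk_lt k) A)
        (measureReal_mono (sepAll_subset_M A 𝓑 hsub hdisj))
  -- pass to the limit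
  have hlimS : Tendsto (fun k => ∑ B ∈ 𝓑, (prodBernoulli (wk k)).real
      ({ω | ∃ b ∈ B, ω ∈ openConn o b} ∩ {ω | ∀ b ∈ B, ∀ a ∈ A \ B, ω ∉ openConn b a})) atTop
      (𝓝 (∑ B ∈ 𝓑, (prodBernoulli w).real
        ({ω | ∃ b ∈ B, ω ∈ openConn o b} ∩ {ω | ∀ b ∈ B, ∀ a ∈ A \ B, ω ∉ openConn b a}))) :=
    tendsto_finsetSum 𝓑 fun B _ => hlimE _
  have hlimt : Tendsto (fun k => t + δ k) atTop (𝓝 t) := by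
    simpa using tendsto_const_nhds.add hδ_lim
  exact le_of_tendsto_of_tendsto' hlimS hlimt hk

/-- **Antichain bound: popular DISJOINT clusters cannot coexist.**  For pairwise disjoint blocks `B ⊆ A`
with `μ(B ↮ A∖B) ≤ t` each: `Σ_B μ(C(o) ∩ A = B) ≤ t`, where `{C(o) ∩ A = B} = {∀ a ∈ A, o ↔ a ↔ a ∈ B}`
(for nonempty `B` this event lies in `{o ↔ B} ∩ {B ↮ A∖B}`; empty blocks are excluded).
[cite: KozmaNitzan2024, Lemma 2 (p. 6) — corollary] -/
theorem disjointClusters_sum_le (w : Sym2 (Fin n) → unitInterval) (A : Finset (Fin n)) (o : Fin n)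
    (𝓑 : Finset (Finset (Fin n))) (hsub : ∀ B ∈ 𝓑, B ⊆ A) (hne : ∀ B ∈ 𝓑, B.Nonempty)
    (hdisj : ∀ B' ∈ 𝓑, ∀ B'' ∈ 𝓑, B' ≠ B'' → Disjoint B' B'') (t : ℝ) (ht : 0 ≤ t)
    (hq : ∀ B ∈ 𝓑, (prodBernoulli w).real {ω | ∀ b ∈ B, ∀ a ∈ A \ B, ω ∉ openConn b a} ≤ t) :
    ∑ B ∈ 𝓑, (prodBernoulli w).real {ω : BondConfig (Fin n) | ∀ a ∈ A, ω ∈ openConn o a ↔ a ∈ B} ≤ t := by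
  refine le_trans (Finset.sum_le_sum fun B hB => measureReal_mono ?_) (blockLonelyRelay w A o 𝓑 hsub hdisj t ht hq)
  intro ω hω
  simp only [mem_setOf_eq] at hω
  obtain ⟨b, hb⟩ := hne B hB
  refine ⟨⟨b, hb, (hω b (hsub B hB hb)).2 hb⟩, fun b' hb' a ha hba => ?_⟩
  obtain ⟨haA, haB⟩ := Finset.mem_sdiff.1 ha
  have hob' : (openGraph ω).Reachable o b' := (hω b' (hsub B hB hb')).2 hb'
  exact haB ((hω a haA).1 (hob'.trans hba))

end Summit.CriticalPhenomena.PercolationContinuityZ3.Theorems
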